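import Summits.QuantumFields.YangMills.Theorems.FluctuationComparisonRegPrIntLS2BetaRelativeLadderHolonomy
import HarnessLib

/-!
# S2β · Q11b-core — THE TOP-STAGE LADDER, GROUP LEVEL: TREE RAILS CARRY NO CHORD, SO A RUNG'S CHORD IS AT MOST `|w|·ρ`
# (any torus, any `GaugeGroup`; the group-level core of (TOP-LAD) in px17 g22's ✓p830137 `supTower_of_liftLadder`)

Cell `ym3-torus` (rung R3 = continuum `SU(2)` YM₃ on T³ at fixed lattice data — NOT d = 4, NOT infinite volume, NOT a mass gap, NOT Clay).  Width seat `ym3-torus-px5` (gen 23);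
crux `stmt-QuantumFields-20520`, LINE g18-1 S2β.  By kernel (✓p830018 ∘ ✓p829725 ∘ ✓p830137): GAP♯∘ ⟸ {h3, (D-stage)×2, LIFT-LADDER}, LIFT-LADDER = (TOP-LAD) ∧ (LIFT-LAD) ∧ (SCT-c);
(TOP-LAD) `a 0 ≤ c 0` is the level-`J+1` (= stage `K−J−1`, one below the top) chord budget.  On the fibre with the stagewise axial gauge (`AxStage`), (4b) ✓`stageChord_treeComb_top`
makes every TREE-COMB bond's chord `1` there, and the stage chord is the plain chord conjugated by the common gauge `g j` (AxStage intertwinings) — so an intra-block bond `⟨y, e⟩`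
reached from a tree rung by a comb walk `w` whose two rails lie on the tree is a RUNG OF A LADDER WITH CHORD-FREE RAILS AND A CHORD-FREE NEAR RUNG.  THIS FILE is that situation at
the GROUP level, abstractly (hypotheses: `W = U` on the rails and on the near rung): the relative ladder loop IS the far-rung chord (§2), hence by Q11a ✓p829361
`dist1_ladder_rel_le` the far-rung chord is at most `|w|·ρ` (§3) — no rail term at all.  The comb geometry (which bonds are tree, `|w| ≤ 2(L−1)`) and the face-crossing bonds are
NOT here (bus 17:48:16Z design question (i)∕(ii)).  `--kind proof --supports stmt-QuantumFields-20520 --as helper`, count-neutral, DEFINITION-FREE (0 `def`, 0 `instance`,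
0 `notation`, 0 `sorry`, default heartbeats); generic `P : Params`, ANY `GaugeGroup G`.

WHAT IS PROVED (sorry-free).
* §1 `holAt_eq_of_agree` — two configurations agreeing on every bond of a step list have the same transport along it.
* §2 ★`dist1_loopRel_eq_farChord` — rails and near rung agree ⟹ `dist1 (loop_W·loop_U⁻¹) = dist1 (U_far⁻¹·W_far)` (`loop_X = holAt X (walk z w)·X⟨walkEnd z w, e⟩·(holAt X (walk (z+e) w))⁻¹·X⟨z,e⟩⁻¹`, Q11a's loop).
* §3 ★★★`dist1_farChord_le_length_mul` — under Q11a's plaquette hypothesis on a site set `S` containing the bottom rail's sites, rails + near rung chord-free ⟹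
  **`dist1 ((U⟨walkEnd z w, e⟩)⁻¹·W⟨walkEnd z w, e⟩) ≤ |w|·ρ`**.

HONEST SCOPE.  Group algebra over Q11a; nothing of Bałaban's analysis is asserted or proved; (TOP-LAD) itself (comb geometry, read sets, the face-crossing bonds, the square and the
`Σ_B`) is NOT here; (TOP-LAD)∕(LIFT-LAD)∕(SCT-c)∕(ST), LOC's discharge, «MULT♭-ax»∕«CRIT-ax», (D-stage), h3, GAP♯∘ (`stub_uniformFibreGapOrbit`, registry 3732b7df UNTOUCHED, 0∕5), S2β, the
five registered stubs, 20520, 19936, 19200, `YM3TorusSU2` NOT proved; no summit statement is proved by a helper; rung R3 — NOT d = 4, NOT infinite volume, NOT a mass gap, NOT Clay;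
the Yang–Mills mass gap is NOT proved.

References: T. Bałaban, CMP **122** (1989) 355–392 [Balaban1989LargeFieldII] (p.382, tree-gauge bonds as loops spanned by plaquettes); CMP **98** (1985) 17–51
[Balaban1985Averaging] ((8) p.18, (19) p.21 — axial gauge in blocks).
-/

set_option autoImplicit false

namespace Summit.QuantumFields.YangMills.Theorems.FluctuationComparisonRegPrIntLS2BetaTopLadderCore

open Literature.MathematicalPhysics.QuantumFieldTheory.Balaban1983to89
open Literature.MathematicalPhysics.QuantumFieldTheory.Balaban1983to89.T4Continuum
open Summit.QuantumFields.YangMills.Theorems.FluctuationComparisonRegPrIntLS2BetaRelativeStokes (dist1_mul_inv_eq_rel)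
open Summit.QuantumFields.YangMills.Theorems.FluctuationComparisonRegPrIntLS2BetaRelativeLadderHolonomy (dist1_ladder_rel_le)

variable {P : Params} {j : ℕ} {G : Type*} [GaugeGroup G]

/-! ## §1 Agreeing configurations have equal transports -/

/-- Two configurations that agree on every bond of a step list have the same parallel transport along it. [folklore] -/
theorem holAt_eq_of_agree (W U : GaugeField P j G) (γ : List (LStep P j)) (h : ∀ s ∈ γ, W s.bond = U s.bond) :
    holAt W γ = holAt U γ := by
  unfold holAt
  congr 1
  exact List.map_congr_left (fun s hs => by rw [h s hs])

/-! ## §2 Chord-free rails and near rung: the relative ladder loop is the far-rung chord -/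

/-- ★ If `W = U` on both rails of the ladder spelled by `w` from `z` (and from `z + e`) and on the near rung `⟨z, e⟩`, then the relative ladder loop of Q11a equals, in `dist1`,
the far-rung chord: `dist1 (loop_W·loop_U⁻¹) = dist1 (U⟨walkEnd z w, e⟩⁻¹·W⟨walkEnd z w, e⟩)`. [cite: Balaban1989LargeFieldII, p.382 (bookkeeping)] -/
theorem dist1_loopRel_eq_farChord (W U : GaugeField P j G) (w : List (Letter P.d)) (z : Site P j) (e : Fin P.d)
    (hrail : ∀ s ∈ walk z w, W s.bond = U s.bond) (hrail' : ∀ s ∈ walk (z.shift e) w, W s.bond = U s.bond) (hnear : W ⟨z, e⟩ = U ⟨z, e⟩) :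
    dist1 ((holAt W (walk z w) * W ⟨walkEnd z w, e⟩ * (holAt W (walk (z.shift e) w))⁻¹ * (W ⟨z, e⟩)⁻¹) *
        (holAt U (walk z w) * U ⟨walkEnd z w, e⟩ * (holAt U (walk (z.shift e) w))⁻¹ * (U ⟨z, e⟩)⁻¹)⁻¹) =
      dist1 ((U ⟨walkEnd z w, e⟩)⁻¹ * W ⟨walkEnd z w, e⟩) := by
  rw [holAt_eq_of_agree W U _ hrail, holAt_eq_of_agree W U _ hrail', hnear]
  set H := holAt U (walk z w)
  set H' := holAt U (walk (z.shift e) w)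
  set X := W ⟨walkEnd z w, e⟩
  set X₀ := U ⟨walkEnd z w, e⟩
  set N := U ⟨z, e⟩
  have key : H * X * H'⁻¹ * N⁻¹ * (H * X₀ * H'⁻¹ * N⁻¹)⁻¹ = H * (X * X₀⁻¹) * H⁻¹ := by group
  rw [key, GaugeGroup.dist1_conj, dist1_mul_inv_eq_rel]

/-! ## §3 The far-rung chord is at most `|w|·ρ` -/

/-- ★★★ **TOP-STAGE LADDER BOUND, GROUP LEVEL**: if the relative plaquettes with source in `S` are `ρ`-small (`dist1 ((U□)⁻¹·(W□)) ≤ ρ`), the bottom rail of the ladder spelled by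
`w` from `z` stays in `S`, and `W = U` on both rails and on the near rung `⟨z, e⟩` (chord-free tree bonds), then the far rung's chord obeys
`dist1 (U⟨walkEnd z w, e⟩⁻¹·W⟨walkEnd z w, e⟩) ≤ |w|·ρ` — Q11a with a vanishing rail term. [cite: Balaban1989LargeFieldII, p.382; Balaban1985Averaging, (19) p.21] -/
theorem dist1_farChord_le_length_mul (W U : GaugeField P j G) {ρ : ℝ} (hρ0 : 0 ≤ ρ) (S : Set (Site P j))
    (hρ : ∀ q : Plaq P j, q.src ∈ S → dist1 ((GaugeField.plaqHol U q)⁻¹ * GaugeField.plaqHol W q) ≤ ρ) (e : Fin P.d)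
    (w : List (Letter P.d)) (z : Site P j) (hS : ∀ i, i ≤ w.length → walkEnd z (w.take i) ∈ S)
    (hrail : ∀ s ∈ walk z w, W s.bond = U s.bond) (hrail' : ∀ s ∈ walk (z.shift e) w, W s.bond = U s.bond) (hnear : W ⟨z, e⟩ = U ⟨z, e⟩) :
    dist1 ((U ⟨walkEnd z w, e⟩)⁻¹ * W ⟨walkEnd z w, e⟩) ≤ w.length * ρ := by
  have h := dist1_ladder_rel_le W U hρ0 S hρ e w z hS
  rw [dist1_loopRel_eq_farChord W U w z e hrail hrail' hnear] at h
  have hsum : ((walk z w).map (fun s : LStep P j => dist1 ((U s.bond)⁻¹ * W s.bond))).sum = 0 := by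
    have hc : (walk z w).map (fun s : LStep P j => dist1 ((U s.bond)⁻¹ * W s.bond)) = (walk z w).map (fun _ => (0 : ℝ)) :=
      List.map_congr_left (fun s hs => by rw [hrail s hs, inv_mul_cancel, GaugeGroup.dist1_one])
    rw [hc, List.map_const', List.sum_replicate, smul_zero]
  rw [hsum, mul_zero, add_zero] at h
  exact h

end Summit.QuantumFields.YangMills.Theorems.FluctuationComparisonRegPrIntLS2BetaTopLadderCore
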